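import Mathlib.GroupTheory.Perm.Sign
import Mathlib.Algebra.MonoidAlgebra.Basic
import Mathlib.RepresentationTheory.Basic
import Mathlib.RepresentationTheory.Intertwining
import Mathlib.RepresentationTheory.Irreducible
import Mathlib.RepresentationTheory.Character
import Mathlib.LinearAlgebra.Trace
import Mathlib.FieldTheory.IsAlgClosed.Basic
import Literature.NumberTheory.DiophantineGeometry.PartitionTableaux
import HarnessLib

-- provenance: harness21/H21/H21/Prelude/ArithGeomL/SymmetricGroupReps.lean @ bb7e77e (interim HEAD d8f2665); M5 mechanical rewrite
/-!
# Representations of the symmetric group: Young symmetrizers, Specht modules,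
Kronecker coefficients (trunk ArithGeomL, item C8)

This file is the `S_d`-side of the notion `gl_sn_irreps_partitions` (irreducible
representations of `GL_n` and of `S_d` are indexed by partitions). For a partition `μ ⊢ d`
and the canonical row-reading tableau of shape `μ` (`Nat.Partition.rowOf`,
`Nat.Partition.colOf` from `PartitionTableaux`), we define

* the row and column stabilizers `rowStabilizer μ`, `colStabilizer μ ≤ Equiv.Perm (Fin d)`;
* the elements `a_μ = ∑_{σ ∈ R} σ`, `b_μ = ∑_{σ ∈ C} sgn(σ) σ` and the Young symmetrizer
  `c_μ = a_μ b_μ` of the group algebra `k[S_d]`;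
* the Specht module `S^μ = k[S_d] c_μ` (a left ideal, an `Ideal (MonoidAlgebra k _)`) with
  its `S_d`-representation
  `spechtRep k μ`, its character `spechtCharacter k μ`;
* the Kronecker coefficients `g(λ, μ, ν) = dim Hom_{S_d}(S^λ ⊗ S^μ, S^ν)`;

and state the classical theorems: `c_μ² = (d!/f^μ) c_μ`, irreducibility and pairwise
non-isomorphy of the Specht modules, completeness of the list in characteristic zero over an
algebraically closed field, `dim S^μ = f^μ`, and the `S₃`-symmetry and character formula for
Kronecker coefficients.

## Sources

* G. D. James, *The Representation Theory of the Symmetric Groups*, LNM 682 (1978), §§4, 11, 20.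
* W. Fulton, J. Harris, *Representation Theory. A First Course*, GTM 129 (1991), §§4.1–4.3.
* W. Fulton, *Young Tableaux*, LMS Student Texts 35 (1997), §7.

## Mathlib

Mathlib (grep at this pin) has `MonoidAlgebra`, `Representation`, `Representation.ofModule'`,
`Representation.tprod`, `Representation.IntertwiningMap`, `Representation.Equiv`,
`Representation.IsIrreducible`, `Representation.character` (with `Representation.char_conj`,
`char_tensor`, `char_iso`, `card_inv_mul_sum_char_mul_char_eq_finrank`), `Equiv.Perm.sign`
and `LinearMap.trace`, all of which we use; in particular `spechtCharacter` is only an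
abbreviation for Mathlib's `Representation.character` of `spechtRep`. Mathlib has no Young
symmetrizers, Specht modules or Kronecker coefficients (grep: `youngSymmetrizer`, `Specht`,
`kronecker`, `rowStabilizer` give no hits).

## Design

* Everything lives in `namespace Literature.CplxAlg`; the coefficient field `k` is explicit, the
  degree `d` implicit, the partition explicit.
* The Specht module is the left ideal `k[S_d] · c_μ`, realised as an `Ideal` (a `Submodule` of
  the group algebra over itself); `Representation.ofModule'` turns the induced `k[S_d]`-module structure
  into a `Representation` on the very same carrier (the `k`-module and `IsScalarTower`
  instances on the submodule are the restriction-of-scalars ones found by instance search).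
* `kroneckerCoeff k λ μ ν := finrank k (Hom_{S_d}(S^λ ⊗ S^μ, S^ν))`. Over a field of
  characteristic zero this equals the more symmetric `dim (S^λ ⊗ S^μ ⊗ S^ν)^{S_d}` because
  Specht modules are self-dual (their characters are real, indeed rational); we avoid the
  iterated tensor product of submodule carriers, on which instance synthesis is fragile.
* This file does not import the `GL`-side (`GLHighestWeight`): the `S_d`-theory is
  Mathlib-only mathematics on top of `PartitionTableaux`.
-/

noncomputable section

open scoped BigOperators TensorProduct

namespace Literature.NumberTheory.DiophantineGeometry

section CplxAlg

variable (k : Type*) [Field k] {d : ℕ}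

/-! ### Row and column stabilizers -/

/-- The row stabilizer `R_μ ≤ S_d` of the canonical row-reading tableau of shape `μ ⊢ d`: the
permutations of `Fin d` preserving each row (James, LNM 682, §4; Fulton–Harris §4.1, the
subgroup `P_λ`). [folklore] -/
def rowStabilizer (μ : Nat.Partition d) : Subgroup (Equiv.Perm (Fin d)) where
  carrier := {σ | ∀ i, μ.rowOf (σ i) = μ.rowOf i}
  one_mem' := fun _ ↦ rfl
  mul_mem' {σ τ} hσ hτ i := by rw [Equiv.Perm.mul_apply, hσ, hτ]
  inv_mem' {σ} hσ i := by rw [← hσ (σ⁻¹ i), Equiv.Perm.coe_inv, Equiv.apply_symm_apply]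

/-- Membership in the row stabilizer: `σ ∈ R_μ` iff `σ` preserves the row of every entry of
the canonical tableau (James, LNM 682, §4). [folklore] -/
@[simp]
theorem mem_rowStabilizer_iff (μ : Nat.Partition d) (σ : Equiv.Perm (Fin d)) :
    σ ∈ rowStabilizer μ ↔ ∀ i, μ.rowOf (σ i) = μ.rowOf i :=
  Iff.rfl

/-- The column stabilizer `C_μ ≤ S_d` of the canonical row-reading tableau of shape `μ ⊢ d`:
the permutations of `Fin d` preserving each column (James, LNM 682, §4; Fulton–Harris §4.1,
the subgroup `Q_λ`). [folklore] -/
def colStabilizer (μ : Nat.Partition d) : Subgroup (Equiv.Perm (Fin d)) where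
  carrier := {σ | ∀ i, μ.colOf (σ i) = μ.colOf i}
  one_mem' := fun _ ↦ rfl
  mul_mem' {σ τ} hσ hτ i := by rw [Equiv.Perm.mul_apply, hσ, hτ]
  inv_mem' {σ} hσ i := by rw [← hσ (σ⁻¹ i), Equiv.Perm.coe_inv, Equiv.apply_symm_apply]

/-- Membership in the column stabilizer: `σ ∈ C_μ` iff `σ` preserves the column of every entry
of the canonical tableau (James, LNM 682, §4). [folklore] -/
@[simp]
theorem mem_colStabilizer_iff (μ : Nat.Partition d) (σ : Equiv.Perm (Fin d)) :
    σ ∈ colStabilizer μ ↔ ∀ i, μ.colOf (σ i) = μ.colOf i :=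
  Iff.rfl

/-! ### Young symmetrizers -/

open scoped Classical in
/-- The row symmetrizer `a_μ = ∑_{σ ∈ R_μ} σ ∈ k[S_d]` (Fulton–Harris §4.1, formula (4.1);
James, LNM 682, §4). [folklore] -/
def rowSymmetrizer (μ : Nat.Partition d) : MonoidAlgebra k (Equiv.Perm (Fin d)) :=
  ∑ σ ∈ (rowStabilizer μ : Set (Equiv.Perm (Fin d))).toFinset,
    MonoidAlgebra.of k (Equiv.Perm (Fin d)) σ

open scoped Classical in
/-- The column antisymmetrizer `b_μ = ∑_{σ ∈ C_μ} sgn(σ) σ ∈ k[S_d]` (Fulton–Harris §4.1,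
formula (4.2); James, LNM 682, §4, the signed column sum `κ_t`). [folklore] -/
def colAntisymmetrizer (μ : Nat.Partition d) : MonoidAlgebra k (Equiv.Perm (Fin d)) :=
  ∑ σ ∈ (colStabilizer μ : Set (Equiv.Perm (Fin d))).toFinset,
    ((Equiv.Perm.sign σ : ℤ) : k) • MonoidAlgebra.of k (Equiv.Perm (Fin d)) σ

/-- The Young symmetrizer `c_μ = a_μ b_μ ∈ k[S_d]` of the canonical tableau of shape `μ ⊢ d`
(Fulton–Harris §4.1, formula (4.3); Fulton, *Young Tableaux*, §7.2). [folklore] -/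
def youngSymmetrizer (μ : Nat.Partition d) : MonoidAlgebra k (Equiv.Perm (Fin d)) :=
  rowSymmetrizer k μ * colAntisymmetrizer k μ

/-! ### Specht modules -/

/-- The Specht module `S^μ = k[S_d] · c_μ`, the left ideal of the group algebra generated by
the Young symmetrizer (Fulton–Harris §4.1, `V_λ = ℂ𝔖_d c_λ`; James, LNM 682, §4). We use
Mathlib's `Ideal` (`= Submodule R R`, a left ideal for the noncommutative ring `k[S_d]`). [folklore] -/
def spechtIdeal (μ : Nat.Partition d) : Ideal (MonoidAlgebra k (Equiv.Perm (Fin d))) :=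
  Ideal.span {youngSymmetrizer k μ}

/-- The Young symmetrizer lies in its Specht module (Fulton–Harris §4.1). [folklore] -/
theorem youngSymmetrizer_mem_spechtIdeal (μ : Nat.Partition d) :
    youngSymmetrizer k μ ∈ spechtIdeal k μ :=
  Ideal.subset_span rfl

/-- The Specht representation of `S_d` on `S^μ = k[S_d] · c_μ`: `σ` acts by left
multiplication by `σ` (Fulton–Harris §4.1, Theorem 4.3; James, LNM 682, §4). Built with
Mathlib's `Representation.ofModule'` from the `k[S_d]`-module structure of the left ideal. [folklore] -/
def spechtRep (μ : Nat.Partition d) :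
    Representation k (Equiv.Perm (Fin d)) (spechtIdeal k μ) :=
  Representation.ofModule' (k := k) (G := Equiv.Perm (Fin d)) (spechtIdeal k μ)

/-- In the Specht representation, `σ ∈ S_d` acts on `x ∈ k[S_d] · c_μ` by left multiplication
by `σ` (Fulton–Harris §4.1). [folklore] -/
theorem spechtRep_apply (μ : Nat.Partition d) (σ : Equiv.Perm (Fin d)) (x : spechtIdeal k μ) :
    (spechtRep k μ σ x : MonoidAlgebra k (Equiv.Perm (Fin d))) =
      MonoidAlgebra.of k (Equiv.Perm (Fin d)) σ * x := by
  simp [spechtRep, Representation.ofModule']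

/-- The character `χ^μ(σ) = tr(σ | S^μ)` of the Specht module `S^μ`
(James, LNM 682, §§6, 20; Fulton–Harris §4.3). This is an abbreviation for Mathlib's
`Representation.character` of `spechtRep k μ`, kept under the outline's name. [folklore] -/
abbrev spechtCharacter (μ : Nat.Partition d) : Equiv.Perm (Fin d) → k :=
  (spechtRep k μ).character

/-- `spechtCharacter` is Mathlib's `Representation.character` of the Specht representation. [folklore] -/
theorem spechtCharacter_eq_character (μ : Nat.Partition d) :
    spechtCharacter k μ = (spechtRep k μ).character :=
  rfl

/-- Unfolding: `χ^μ(σ)` is the trace of `σ` acting on `S^μ` (James, LNM 682, §6). [folklore] -/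
theorem spechtCharacter_apply (μ : Nat.Partition d) (σ : Equiv.Perm (Fin d)) :
    spechtCharacter k μ σ = LinearMap.trace k _ (spechtRep k μ σ) :=
  rfl

/-- The Kronecker coefficient `g(λ, μ, ν)`: the multiplicity of `S^ν` in `S^λ ⊗ S^μ`, defined
as `dim_k Hom_{S_d}(S^λ ⊗ S^μ, S^ν)` (Fulton–Harris §4.3, Exercise 4.51; James–Kerber,
*The Representation Theory of the Symmetric Group*, §2.9). In characteristic zero this equals
`dim (S^λ ⊗ S^μ ⊗ S^ν)^{S_d}`, since Specht modules are self-dual over `ℚ`; hence the full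
`S₃`-symmetry `kroneckerCoeff_comm₁₂`, `kroneckerCoeff_comm₂₃`. [folklore] -/
def kroneckerCoeff (lam μ ν : Nat.Partition d) : ℕ :=
  Module.finrank k (((spechtRep k lam).tprod (spechtRep k μ)).IntertwiningMap (spechtRep k ν))

/-! ### The classical theorems -/

/-- The Young symmetrizer is a quasi-idempotent: `c_μ² = n_μ c_μ` with `n_μ = d! / f^μ`
(Fulton–Harris, Lemma 4.26 and Exercise 4.24; James, LNM 682, §4 with Theorem 20.1). The
natural-number division is exact by the hook length formula
(`numStandardTableaux_mul_prod_hookLength`). [cite: FultonHarrisGTM129, Lemma 4.26 and Exercise 4.24] [cite: JamesLNM682, §4 and Theorem 20.1] -/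
def youngSymmetrizer_mul_self : Prop :=
  ∀ [CharZero k] (μ : Nat.Partition d),
    youngSymmetrizer k μ * youngSymmetrizer k μ =
      ((d.factorial / numStandardTableaux μ : ℕ) : k) • youngSymmetrizer k μ

/-- The Young symmetrizer is nonzero: the coefficient of `1` in `c_μ` is `1`, as
`R_μ ∩ C_μ = 1`; this holds over any field (Fulton–Harris, Lemma 4.26 and its proof; James,
LNM 682, §4). [cite: FultonHarrisGTM129, Lemma 4.26 (proof)] -/
def youngSymmetrizer_ne_zero : Prop :=
  ∀ (μ : Nat.Partition d),
    youngSymmetrizer k μ ≠ 0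

/-- Specht modules are irreducible in characteristic zero (Fulton–Harris, Theorem 4.3;
James, LNM 682, Theorem 4.12 with §11). [cite: FultonHarrisGTM129, Theorem 4.3] [cite: JamesLNM682, Theorem 4.12] -/
def isIrreducible_spechtRep : Prop :=
  ∀ [CharZero k] (μ : Nat.Partition d),
    (spechtRep k μ).IsIrreducible

/-- Specht modules of distinct partitions are non-isomorphic: `S^λ ≅ S^μ` iff `λ = μ`
(Fulton–Harris, Theorem 4.3 and Lemma 4.23; James, LNM 682, Theorem 4.12). The short name is
the one fixed by the outline (item C8). [cite: FultonHarrisGTM129, Theorem 4.3 and Lemma 4.23] [cite: JamesLNM682, Theorem 4.12] -/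
def nonempty_equiv_iff : Prop :=
  ∀ [CharZero k] {lam μ : Nat.Partition d},
    Nonempty ((spechtRep k lam).Equiv (spechtRep k μ)) ↔ lam = μ

/-- Completeness: over an algebraically closed field of characteristic zero every irreducible
finite-dimensional representation of `S_d` is isomorphic to a Specht module `S^μ` for some
partition `μ ⊢ d` (Fulton–Harris, Theorem 4.3; James, LNM 682, Theorem 4.12 and
Theorem 11.5). Irreducibility is the Mathlib class `Representation.IsIrreducible`, taken as an
instance argument. [cite: FultonHarrisGTM129, Theorem 4.3] [cite: JamesLNM682, Theorem 4.12] -/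
def exists_equiv_spechtRep_of_isIrreducible : Prop :=
  ∀ [IsAlgClosed k] [CharZero k] {V : Type*} [AddCommGroup V] [Module k V] [FiniteDimensional k V] (ρ : Representation k (Equiv.Perm (Fin d)) V) [ρ.IsIrreducible],
    ∃ μ : Nat.Partition d, Nonempty (ρ.Equiv (spechtRep k μ))

/-- The dimension of the Specht module `S^μ` is the number `f^μ` of standard Young tableaux of
shape `μ` (Fulton–Harris, Problem 4.47 and (4.11); James, LNM 682, Theorem 8.4 with §20;
Fulton, *Young Tableaux*, §7.2, Proposition 2). [cite: FultonHarrisGTM129, Problem 4.47 and (4.11)] [cite: JamesLNM682, Theorem 8.4] -/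
def finrank_spechtIdeal : Prop :=
  ∀ [CharZero k] (μ : Nat.Partition d),
    Module.finrank k (spechtIdeal k μ) = numStandardTableaux μ

/-- Symmetry of Kronecker coefficients in the first two arguments:
`g(λ, μ, ν) = g(μ, λ, ν)`; valid over any field, via the equivariant isomorphism
`S^λ ⊗ S^μ ≅ S^μ ⊗ S^λ` (Fulton–Harris, Exercise 4.51; James–Kerber §2.9). [cite: FultonHarrisGTM129, Exercise 4.51] -/
def kroneckerCoeff_comm₁₂ : Prop :=
  ∀ (lam μ ν : Nat.Partition d),
    kroneckerCoeff k lam μ ν = kroneckerCoeff k μ lam ν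

/-- Symmetry of Kronecker coefficients in the last two arguments:
`g(λ, μ, ν) = g(λ, ν, μ)`; together with `kroneckerCoeff_comm₁₂` this gives the full
`S₃`-symmetry, a consequence of the self-duality of Specht modules in characteristic zero
(Fulton–Harris, Exercise 4.51; James–Kerber §2.9). [cite: FultonHarrisGTM129, Exercise 4.51] -/
def kroneckerCoeff_comm₂₃ : Prop :=
  ∀ [CharZero k] (lam μ ν : Nat.Partition d),
    kroneckerCoeff k lam μ ν = kroneckerCoeff k lam ν μ

/-- The character formula for Kronecker coefficients:
`d! · g(λ, μ, ν) = ∑_{σ ∈ S_d} χ^λ(σ) χ^μ(σ) χ^ν(σ)` (Fulton–Harris, Exercise 4.51 with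
Corollary 2.16 and §2.2; James–Kerber §2.9). [cite: FultonHarrisGTM129, Exercise 4.51 with Corollary 2.16] -/
def kroneckerCoeff_eq_sum_spechtCharacter : Prop :=
  ∀ [CharZero k] (lam μ ν : Nat.Partition d),
    ((d.factorial * kroneckerCoeff k lam μ ν : ℕ) : k) =
      ∑ σ : Equiv.Perm (Fin d),
        spechtCharacter k lam σ * spechtCharacter k μ σ * spechtCharacter k ν σ

/-- The Specht character is a class function: `χ^μ(τ σ τ⁻¹) = χ^μ(σ)`
(James, LNM 682, §6; Fulton–Harris, Proposition 2.1). Immediate from Mathlib's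
`Representation.char_conj`. [folklore] -/
theorem spechtCharacter_conj (μ : Nat.Partition d) (σ τ : Equiv.Perm (Fin d)) :
    spechtCharacter k μ (τ * σ * τ⁻¹) = spechtCharacter k μ σ :=
  (spechtRep k μ).char_conj σ τ

end CplxAlg

end Literature.NumberTheory.DiophantineGeometry
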